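import Mathlib
import HarnessLib
import Summits.AtomisticToContinuum.HydrodynamicLimit.Theses.OneFlightGossipEngine
import Literature.MathematicalPhysics.KineticTheory.HardSphereEulerProofs
import Literature.Analysis.FluidPDE.HardSphereFlowJointMeasurable

/-!
# Assembly of line `Sketch` for the crux `KineticCurrentsWindowLDUniform` (stmt-AtomisticToContinuum-14662)

`stub_assembly` (registered stub S7 of the lead skeleton `Cruxes/KineticCurrentsWindowLDUniform/Lines/Sketch.lean`):
the six other registered stubs of the line imply the crux
`OneFlightGossipEngine.KineticCurrentsWindowLDUniform`. The proof is bookkeeping: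

* a.e. on the good set the window functional of `F = F' + R`, `|R| ≤ Y`, splits as
  `β S(F) ≤ β S(F') + |β| S(Y)` (interval integrability of continuous observables along good
  trajectories, stub S4);
* Hölder with exponents `(2, 2)` in `ℝ≥0∞` (`lintegral_exp_le_of_le_add`);
* the first factor is the bounded-class residual (stub S6) at `2β`;
* the second factor is bounded by Jensen in time (S1), the window transfer (S5) and the static fibre
  exponential moment (S2) fed by the truncation's tail clause (S3);
* `β₀ := min (β₁/2) (κ₀/(2q))`, `δ = η = ε/2`.

References: H. Spohn, *Large Scale Dynamics of Interacting Particles* (1991), Part I §2.3–§3 (local Gibbs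
laws); the module docstring of the skeleton for the line's rationale.
-/

noncomputable section

open MeasureTheory Set Filter
open scoped ENNReal Topology

namespace Summit.AtomisticToContinuum.HydrodynamicLimit.Theorems.KineticCurrentsWindowLDUniformSketch

open Literature.Analysis.FluidPDE (HardSphereFlow Config localMaxwellian)
open Literature.MathematicalPhysics.KineticTheory (T3 V3 hsDiameter localGibbsLaw localGibbsMeasure)
open Summit.AtomisticToContinuum.HydrodynamicLimit.Theses.OneFlightGossipEngine
  (KineticCurrentsWindowLDUniform)

/-! ### Generic measure-theoretic steps -/

section Generic

variable {α : Type*} [MeasurableSpace α]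

/-- Hölder with exponents `(2,2)` for exponentials: if `u ≤ v + w` a.e. then
`∫⁻ e^u ≤ (∫⁻ e^{2v})^{1/2} (∫⁻ e^{2w})^{1/2}`. [folklore] -/
theorem lintegral_exp_le_of_le_add (μ : Measure α) {u v w : α → ℝ}
    (huv : ∀ᵐ x ∂μ, u x ≤ v x + w x) (hv : AEMeasurable v μ) (hw : AEMeasurable w μ) :
    ∫⁻ x, ENNReal.ofReal (Real.exp (u x)) ∂μ ≤
      (∫⁻ x, ENNReal.ofReal (Real.exp (2 * v x)) ∂μ) ^ (1 / 2 : ℝ) *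
        (∫⁻ x, ENNReal.ofReal (Real.exp (2 * w x)) ∂μ) ^ (1 / 2 : ℝ) := by
  have hf : AEMeasurable (fun x => ENNReal.ofReal (Real.exp (v x))) μ :=
    (Real.measurable_exp.comp_aemeasurable hv).ennreal_ofReal
  have hg : AEMeasurable (fun x => ENNReal.ofReal (Real.exp (w x))) μ :=
    (Real.measurable_exp.comp_aemeasurable hw).ennreal_ofReal
  calc ∫⁻ x, ENNReal.ofReal (Real.exp (u x)) ∂μ
      ≤ ∫⁻ x, ((fun x => ENNReal.ofReal (Real.exp (v x))) *
          (fun x => ENNReal.ofReal (Real.exp (w x)))) x ∂μ := by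
        refine lintegral_mono_ae ?_
        filter_upwards [huv] with x hx
        simp only [Pi.mul_apply]
        rw [← ENNReal.ofReal_mul (Real.exp_pos _).le, ← Real.exp_add]
        exact ENNReal.ofReal_le_ofReal (Real.exp_le_exp.2 hx)
    _ ≤ (∫⁻ x, ENNReal.ofReal (Real.exp (v x)) ^ (2 : ℝ) ∂μ) ^ (1 / 2 : ℝ) *
          (∫⁻ x, ENNReal.ofReal (Real.exp (w x)) ^ (2 : ℝ) ∂μ) ^ (1 / 2 : ℝ) :=
        ENNReal.lintegral_mul_le_Lp_mul_Lq μ Real.HolderConjugate.two_two hf hg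
    _ = _ := by
        have h2 : ∀ y : ℝ, ENNReal.ofReal (Real.exp y) ^ (2 : ℝ) = ENNReal.ofReal (Real.exp (2 * y)) := by
          intro y
          rw [ENNReal.ofReal_rpow_of_nonneg (Real.exp_pos _).le (by norm_num), ← Real.exp_mul,
            mul_comm]
        simp_rw [h2]

/-- If `1 ≤ x` and `0 ≤ r ≤ 1` then `x ^ r ≤ x` in `ℝ≥0∞`. [folklore] -/
theorem ennreal_rpow_le_self_of_one_le {x : ℝ≥0∞} (hx : 1 ≤ x) {r : ℝ} (hr : r ≤ 1) :
    x ^ r ≤ x := by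
  conv_rhs => rw [← ENNReal.rpow_one x]
  exact ENNReal.rpow_le_rpow_of_exponent_le hx hr

end Generic


/-! ### Pathwise splitting of a window term -/

section Pathwise

/-- Pathwise splitting of one window term: if `F'` and `F - F'` are interval integrable along the
curve `γ` on `[0, w]`, `Y` too, and `|F - F'| ≤ Y`, then
`β w⁻¹∫₀ʷ F(γ) ≤ β w⁻¹∫₀ʷ F'(γ) + |β| w⁻¹∫₀ʷ Y(γ)`. [folklore] -/
theorem window_term_split {γ : ℝ → T3 × V3} {F F' Y : T3 × V3 → ℝ} {w : ℝ} (hw : 0 ≤ w)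
    (hF' : IntervalIntegrable (fun r => F' (γ r)) volume 0 w)
    (hR : IntervalIntegrable (fun r => F (γ r) - F' (γ r)) volume 0 w)
    (hY : IntervalIntegrable (fun r => Y (γ r)) volume 0 w)
    (hRY : ∀ y, |F y - F' y| ≤ Y y) (β : ℝ) :
    β * (w⁻¹ * ∫ r in (0 : ℝ)..w, F (γ r)) ≤
      β * (w⁻¹ * ∫ r in (0 : ℝ)..w, F' (γ r)) + |β| * (w⁻¹ * ∫ r in (0 : ℝ)..w, Y (γ r)) := by
  have hsplit : (fun r => F (γ r)) = fun r => F' (γ r) + (F (γ r) - F' (γ r)) := by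
    funext r; ring
  have hint : ∫ r in (0 : ℝ)..w, F (γ r) =
      (∫ r in (0 : ℝ)..w, F' (γ r)) + ∫ r in (0 : ℝ)..w, (F (γ r) - F' (γ r)) := by
    rw [hsplit, intervalIntegral.integral_add hF' hR]
  have habs : |∫ r in (0 : ℝ)..w, (F (γ r) - F' (γ r))| ≤ ∫ r in (0 : ℝ)..w, Y (γ r) :=
    (intervalIntegral.abs_integral_le_integral_abs hw).trans
      (intervalIntegral.integral_mono_on hw hR.abs hY fun r _ => hRY (γ r))
  have hwi : 0 ≤ w⁻¹ := inv_nonneg.2 hw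
  rw [hint, mul_add, mul_add]
  refine add_le_add le_rfl ?_
  calc β * (w⁻¹ * ∫ r in (0 : ℝ)..w, (F (γ r) - F' (γ r)))
      ≤ |β * (w⁻¹ * ∫ r in (0 : ℝ)..w, (F (γ r) - F' (γ r)))| := le_abs_self _
    _ = |β| * (w⁻¹ * |∫ r in (0 : ℝ)..w, (F (γ r) - F' (γ r))|) := by
        rw [abs_mul, abs_mul, abs_of_nonneg hwi]
    _ ≤ |β| * (w⁻¹ * ∫ r in (0 : ℝ)..w, Y (γ r)) :=
        mul_le_mul_of_nonneg_left (mul_le_mul_of_nonneg_left habs hwi) (abs_nonneg β)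

end Pathwise

/-! ### Frame facts -/

section Frame

/-- On `𝕋³` the Haar measure is a probability measure, so `∫ a ≤ sup a` for a continuous `a`.
[folklore] -/
theorem integral_le_iSup_T3 {a : T3 → ℝ} (ha : Continuous a) : ∫ x, a x ≤ ⨆ x, a x := by
  have hbdd : BddAbove (Set.range a) := (isCompact_range ha).bddAbove
  have hle : ∀ x, a x ≤ ⨆ x, a x := fun x => le_ciSup hbdd x
  calc ∫ x, a x ≤ ∫ _x : T3, (⨆ x, a x) :=
        integral_mono (Literature.MathematicalPhysics.KineticTheory.integrable_of_continuous_T3 ha)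
          (integrable_const _) hle
    _ = ⨆ x, a x := by simp

end Frame

/-! ### The assembly -/

/-- **Registered stub S7 of line `Sketch` — ASSEMBLY.** The six other registered stubs of the line
(S1 Jensen in time for window sums; S2 static fibre exponential moments under the local Gibbs measure;
S3 truncation of the class with radial re-orthogonalisation; S4 pathwise window integrability on the
good set; S5 window transfer = Rényi quasi-invariance of the local Gibbs law over a kinetic window;
S6 the bounded-class residual `C⁺`) imply the crux `OneFlightGossipEngine.KineticCurrentsWindowLDUniform`.
[folklore] -/
theorem stub_assembly :
    (∀ (Ω : Type) [MeasurableSpace Ω] (μ : Measure Ω) (S : Set Ω), MeasurableSet S → μ Sᶜ = 0 →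
        ∀ (T : ℝ → Ω → Ω), Measurable (fun p : S × ℝ => T p.2 (p.1 : Ω)) →
        ∀ (n : ℕ) (Y : Fin n → Ω → ℝ), (∀ i, Measurable (Y i)) → (∀ i ω, 0 ≤ Y i ω) →
        ∀ w : ℝ, 0 < w →
          ∫⁻ ω, ENNReal.ofReal (Real.exp (∑ i, w⁻¹ * ∫ r in (0 : ℝ)..w, Y i (T r ω))) ∂μ ≤
            ⨆ r ∈ Set.Icc (0 : ℝ) w, ∫⁻ ω, ENNReal.ofReal (Real.exp (∑ i, Y i (T r ω))) ∂μ) →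
    (∀ (a θ₀ : T3 → ℝ) (u₀ : T3 → V3), Continuous a → Continuous θ₀ → Continuous u₀ →
        (∀ x, 0 < a x) → (∀ x, 0 < θ₀ x) → ∀ σ : ℝ, 0 < σ → σ ≤ 1 / 2 → ∀ N : ℕ,
        ∀ g : T3 × V3 → ℝ≥0∞, Measurable g → ∀ K : ℝ≥0∞,
        (∀ x : T3, ∫⁻ v, g (x, v) * ENNReal.ofReal (localMaxwellian 1 (θ₀ x) (u₀ x) v) ≤ K) →
          ∫⁻ z, ∏ i, g (z i) ∂(localGibbsMeasure σ a u₀ θ₀ N) ≤ K ^ (N + 1)) →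
    (∀ (θ₀ : T3 → ℝ) (u₀ : T3 → V3), Continuous θ₀ → Continuous u₀ → (∀ x, 0 < θ₀ x) →
        ∀ (A : T3 → Fin 3 → Fin 3 → ℝ) (b : T3 → V3) (G : T3 × ℝ → ℝ),
        Continuous A → Continuous b → Continuous G →
        ∀ (F : T3 × V3 → ℝ), (∀ y, F y =
          (∑ j : Fin 3, ∑ k : Fin 3, A y.1 j k * ((y.2 - u₀ y.1) j * (y.2 - u₀ y.1) k)) +
            (∑ j : Fin 3, b y.1 j * (y.2 - u₀ y.1) j) * G (y.1, ‖y.2 - u₀ y.1‖ ^ 2)) →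
        ∀ C : ℝ, (∀ y, |F y| ≤ C * (1 + ‖y.2‖ ^ 2)) →
        (∀ x, ∫ v, F (x, v) * localMaxwellian 1 (θ₀ x) (u₀ x) v = 0) →
        (∀ x (j : Fin 3), ∫ v, F (x, v) * v j * localMaxwellian 1 (θ₀ x) (u₀ x) v = 0) →
        (∀ x, ∫ v, F (x, v) * ‖v‖ ^ 2 * localMaxwellian 1 (θ₀ x) (u₀ x) v = 0) →
        ∃ C₁ : ℝ, 0 ≤ C₁ ∧ ∃ κ₀ : ℝ, 0 < κ₀ ∧ ∀ η : ℝ, 0 < η →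
          ∃ (H' G' : T3 × ℝ → ℝ), Continuous H' ∧ Continuous G' ∧
          ∃ (F' Y : T3 × V3 → ℝ), (∀ y, F' y =
            H' (y.1, ‖y.2 - u₀ y.1‖ ^ 2) *
                (∑ j : Fin 3, ∑ k : Fin 3, A y.1 j k * ((y.2 - u₀ y.1) j * (y.2 - u₀ y.1) k)) +
              (∑ j : Fin 3, b y.1 j * (y.2 - u₀ y.1) j) * G' (y.1, ‖y.2 - u₀ y.1‖ ^ 2)) ∧
            Continuous Y ∧ (∀ y, 0 ≤ Y y) ∧
            (∃ B : ℝ, ∀ y, |F' y| ≤ B) ∧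
            (∀ y, |F' y| ≤ C₁ * (1 + ‖y.2‖ ^ 2)) ∧
            (∀ x, ∫ v, F' (x, v) * localMaxwellian 1 (θ₀ x) (u₀ x) v = 0) ∧
            (∀ x (j : Fin 3), ∫ v, F' (x, v) * v j * localMaxwellian 1 (θ₀ x) (u₀ x) v = 0) ∧
            (∀ x, ∫ v, F' (x, v) * ‖v‖ ^ 2 * localMaxwellian 1 (θ₀ x) (u₀ x) v = 0) ∧
            (∀ y, |F y - F' y| ≤ Y y) ∧
            (∀ x, ∫⁻ v, ENNReal.ofReal (Real.exp (κ₀ * Y (x, v)) * localMaxwellian 1 (θ₀ x) (u₀ x) v)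
              ≤ ENNReal.ofReal (Real.exp η))) →
    (∀ (σ : ℝ) (N : ℕ)
        (Φ : HardSphereFlow (Literature.Analysis.FluidPDE.Torus.geometry (Fin 3)) (hsDiameter σ N) (N + 1)),
        ∀ z ∈ Φ.good, ∀ (f : T3 × V3 → ℝ), Continuous f → ∀ (i : Fin (N + 1)) (a b : ℝ),
          IntervalIntegrable (fun r => f ((Φ.flow r z) i)) volume a b) →
    (∀ (a θ₀ : T3 → ℝ) (u₀ : T3 → V3), Continuous a → Continuous θ₀ → Continuous u₀ →
        (∀ x, 0 < a x) → (∀ x, 0 < θ₀ x) → ∀ σ : ℝ, 0 < σ → σ ≤ 1 / 2 →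
        ∃ q : ℝ, 1 ≤ q ∧ ∀ τ : ℝ, 0 < τ → ∀ δ : ℝ, 0 < δ →
        ∀ Φ : (N : ℕ) →
          HardSphereFlow (Literature.Analysis.FluidPDE.Torus.geometry (Fin 3)) (hsDiameter σ N) (N + 1),
        ∃ N₀ : ℕ, ∀ N : ℕ, N₀ ≤ N → ∀ r ∈ Set.Icc (0 : ℝ) (τ * ((N : ℝ) + 1) ^ (-(1 / 3 : ℝ))),
        ∀ G : Config (N + 1) (Fin 3) T3 → ℝ≥0∞, Measurable G →
          ∫⁻ z, G ((Φ N).flow r z) ∂(localGibbsLaw σ a u₀ θ₀ N (Φ N)) ≤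
            ENNReal.ofReal (Real.exp (δ * ((N : ℝ) + 1))) *
              (∫⁻ z, G z ^ q ∂(localGibbsLaw σ a u₀ θ₀ N (Φ N))) ^ (1 / q)) →
    (∃ η₀ : ℝ, 0 < η₀ ∧ ∀ (a θ₀ : T3 → ℝ) (u₀ : T3 → V3), Continuous a → Continuous θ₀ → Continuous u₀ →
        (∀ x, 0 < a x) → (∀ x, 0 < θ₀ x) → ∀ σ : ℝ, 0 < σ → σ ^ 3 * (⨆ x, a x) ≤ η₀ * ∫ x, a x →
        ∀ Φ : (N : ℕ) →
          HardSphereFlow (Literature.Analysis.FluidPDE.Torus.geometry (Fin 3)) (hsDiameter σ N) (N + 1),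
        ∀ C : ℝ, 0 ≤ C → ∃ β₀ : ℝ, 0 < β₀ ∧
        ∀ (A : T3 → Fin 3 → Fin 3 → ℝ) (H : T3 × ℝ → ℝ) (b : T3 → V3) (G : T3 × ℝ → ℝ),
        Continuous A → Continuous H → Continuous b → Continuous G →
        ∀ (F : T3 × V3 → ℝ), (∀ y, F y =
          H (y.1, ‖y.2 - u₀ y.1‖ ^ 2) *
              (∑ j : Fin 3, ∑ k : Fin 3, A y.1 j k * ((y.2 - u₀ y.1) j * (y.2 - u₀ y.1) k)) +
            (∑ j : Fin 3, b y.1 j * (y.2 - u₀ y.1) j) * G (y.1, ‖y.2 - u₀ y.1‖ ^ 2)) →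
        (∃ B : ℝ, ∀ y, |F y| ≤ B) → (∀ y, |F y| ≤ C * (1 + ‖y.2‖ ^ 2)) →
        (∀ x, ∫ v, F (x, v) * localMaxwellian 1 (θ₀ x) (u₀ x) v = 0) →
        (∀ x (j : Fin 3), ∫ v, F (x, v) * v j * localMaxwellian 1 (θ₀ x) (u₀ x) v = 0) →
        (∀ x, ∫ v, F (x, v) * ‖v‖ ^ 2 * localMaxwellian 1 (θ₀ x) (u₀ x) v = 0) →
        ∀ β : ℝ, |β| ≤ β₀ → ∀ ε : ℝ, 0 < ε → ∃ τ : ℝ, 0 < τ ∧ ∃ N₀ : ℕ, ∀ N : ℕ, N₀ ≤ N →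
          ∫⁻ z, ENNReal.ofReal (Real.exp (β * ∑ i : Fin (N + 1),
            (τ * ((N : ℝ) + 1) ^ (-(1 / 3 : ℝ)))⁻¹ *
              ∫ r in (0 : ℝ)..(τ * ((N : ℝ) + 1) ^ (-(1 / 3 : ℝ))), F (((Φ N).flow r z) i)))
            ∂(localGibbsLaw σ a u₀ θ₀ N (Φ N)) ≤ ENNReal.ofReal (Real.exp (ε * ((N : ℝ) + 1)))) →
    KineticCurrentsWindowLDUniform := by
  intro hJ hFib hTr hPW hWT hC6
  obtain ⟨η₁, hη₁, hC6⟩ := hC6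
  refine ⟨min η₁ (1 / 8), lt_min hη₁ (by norm_num), ?_⟩
  intro a θ₀ u₀ ha hθ hu ha0 hθ0 σ hσ hguard Φ A b G hA hb hG hgrowth h1 hv h2
  obtain ⟨C, hC⟩ := hgrowth
  -- the functional of the crux
  set F : T3 × V3 → ℝ := fun y =>
    (∑ j : Fin 3, ∑ k : Fin 3, A y.1 j k * ((y.2 - u₀ y.1) j * (y.2 - u₀ y.1) k)) +
      (∑ j : Fin 3, b y.1 j * (y.2 - u₀ y.1) j) * G (y.1, ‖y.2 - u₀ y.1‖ ^ 2) with hFdef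
  have hFc : Continuous F := by
    rw [hFdef]
    fun_prop
  -- the activity guard: `σ³ sup a ≤ η₁ ∫ a` and `σ ≤ 1/2`
  have hsup_bdd : BddAbove (Set.range a) := (isCompact_range ha).bddAbove
  have hsup_pos : 0 < ⨆ x, a x := lt_of_lt_of_le (ha0 0) (le_ciSup hsup_bdd 0)
  have hint_le : ∫ x, a x ≤ ⨆ x, a x := integral_le_iSup_T3 ha
  have hint_nn : 0 ≤ ∫ x, a x := integral_nonneg fun x => (ha0 x).le
  have hguard1 : σ ^ 3 * (⨆ x, a x) ≤ η₁ * ∫ x, a x :=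
    hguard.trans (mul_le_mul_of_nonneg_right (min_le_left _ _) hint_nn)
  have hσ2 : σ ≤ 1 / 2 := by
    have h8 : σ ^ 3 * (⨆ x, a x) ≤ 1 / 8 * (⨆ x, a x) :=
      hguard.trans ((mul_le_mul_of_nonneg_right (min_le_right _ _) hint_nn).trans
        (mul_le_mul_of_nonneg_left hint_le (by norm_num)))
    have h8' : σ ^ 3 ≤ (1 / 2) ^ 3 := by nlinarith
    exact le_of_pow_le_pow_left₀ (by norm_num) (by norm_num) h8'
  -- S3: the truncation constants `C₁, κ₀`
  obtain ⟨C₁, hC₁, κ₀, hκ₀, hTrunc⟩ :=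
    hTr θ₀ u₀ hθ hu hθ0 A b G hA hb hG F (fun y => rfl) C hC h1 hv h2
  -- S6: `β₁` for the growth constant `C₁`
  obtain ⟨β₁, hβ₁, hBdd⟩ := hC6 a θ₀ u₀ ha hθ hu ha0 hθ0 σ hσ hguard1 Φ C₁ hC₁
  -- S5: the transfer exponent `q`
  obtain ⟨q, hq, hWT⟩ := hWT a θ₀ u₀ ha hθ hu ha0 hθ0 σ hσ hσ2
  have hq0 : 0 < q := one_pos.trans_le hq
  refine ⟨min (β₁ / 2) (κ₀ / (2 * q)), lt_min (by positivity) (by positivity), ?_⟩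
  intro β hβ ε hε
  have hβ1 : |β| ≤ β₁ / 2 := hβ.trans (min_le_left _ _)
  have hβ2 : |β| ≤ κ₀ / (2 * q) := hβ.trans (min_le_right _ _)
  have hqβ : q * (2 * |β|) ≤ κ₀ := by
    rw [le_div_iff₀ (by positivity)] at hβ2
    linarith
  -- truncation at tail level `η = ε/2`
  obtain ⟨H', G', hH', hG', F', Y, hF'def, hYc, hY0, hB, hF'gr, h1', hv', h2', hRY, hYexp⟩ :=
    hTrunc (ε / 2) (by positivity)
  have hF'c : Continuous F' := by
    rw [show F' = fun y => H' (y.1, ‖y.2 - u₀ y.1‖ ^ 2) *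
        (∑ j : Fin 3, ∑ k : Fin 3, A y.1 j k * ((y.2 - u₀ y.1) j * (y.2 - u₀ y.1) k)) +
        (∑ j : Fin 3, b y.1 j * (y.2 - u₀ y.1) j) * G' (y.1, ‖y.2 - u₀ y.1‖ ^ 2) from funext hF'def]
    fun_prop
  have hRc : Continuous fun y => F y - F' y := hFc.sub hF'c
  -- S6 on `F'` at `2β`, precision `ε`
  have h2β : |2 * β| ≤ β₁ := by rw [abs_mul, abs_two]; linarith
  obtain ⟨τ, hτ, N₁, hN₁⟩ :=
    hBdd A H' b G' hA hH' hb hG' F' hF'def hB hF'gr h1' hv' h2' (2 * β) h2β ε hε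
  -- S5 with this `τ` and `δ = ε/2`
  obtain ⟨N₂, hN₂⟩ := hWT τ hτ (ε / 2) (by positivity) Φ
  refine ⟨τ, hτ, max N₁ N₂, fun N hN => ?_⟩
  have hNN₁ : N₁ ≤ N := le_of_max_le_left hN
  have hNN₂ : N₂ ≤ N := le_of_max_le_right hN
  -- fixed `N`: window, law, good set
  set w : ℝ := τ * ((N : ℝ) + 1) ^ (-(1 / 3 : ℝ)) with hwdef
  have hw : 0 < w := by positivity
  set P := localGibbsLaw σ a u₀ θ₀ N (Φ N) with hPdef
  have hPac : P ≪ Literature.Analysis.FluidPDE.liouville (Literature.Analysis.FluidPDE.Torus.geometry (Fin 3))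
      (N + 1) (hsDiameter σ N) := by
    rw [hPdef, Literature.MathematicalPhysics.KineticTheory.localGibbsLaw,
      Literature.Analysis.FluidPDE.particleLaw_eq]
    exact withDensity_absolutelyContinuous _ _
  have hPgood : P (Φ N).goodᶜ = 0 := hPac (Φ N).measure_compl_good
  have hae : ∀ᵐ z ∂P, z ∈ (Φ N).good := mem_ae_iff.2 hPgood
  -- Step 1: pathwise splitting, a.e.
  have hsplit : ∀ᵐ z ∂P, β * ∑ i, w⁻¹ * ∫ r in (0 : ℝ)..w, F (((Φ N).flow r z) i) ≤
      (β * ∑ i, w⁻¹ * ∫ r in (0 : ℝ)..w, F' (((Φ N).flow r z) i)) +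
        |β| * ∑ i, w⁻¹ * ∫ r in (0 : ℝ)..w, Y (((Φ N).flow r z) i) := by
    filter_upwards [hae] with z hz
    rw [Finset.mul_sum, Finset.mul_sum, Finset.mul_sum, ← Finset.sum_add_distrib]
    refine Finset.sum_le_sum fun i _ => ?_
    exact window_term_split (γ := fun r => ((Φ N).flow r z) i) hw.le
      (hPW σ N (Φ N) z hz F' hF'c i 0 w) (hPW σ N (Φ N) z hz _ hRc i 0 w)
      (hPW σ N (Φ N) z hz Y hYc i 0 w) hRY β
  -- measurability of the two window sums
  have hmeasF' : AEMeasurable (fun z => β * ∑ i, w⁻¹ * ∫ r in (0 : ℝ)..w, F' (((Φ N).flow r z) i)) P := by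
    refine AEMeasurable.const_mul (Finset.aemeasurable_fun_sum _ fun i _ => ?_) _
    exact ((Φ N).aemeasurable_intervalIntegral_comp_flow_torus (f := fun z => F' (z i))
      (hF'c.measurable.comp (measurable_pi_apply i)) 0 w hPgood).const_mul _
  have hmeasY : AEMeasurable (fun z => |β| * ∑ i, w⁻¹ * ∫ r in (0 : ℝ)..w, Y (((Φ N).flow r z) i)) P := by
    refine AEMeasurable.const_mul (Finset.aemeasurable_fun_sum _ fun i _ => ?_) _
    exact ((Φ N).aemeasurable_intervalIntegral_comp_flow_torus (f := fun z => Y (z i))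
      (hYc.measurable.comp (measurable_pi_apply i)) 0 w hPgood).const_mul _
  -- Step 2: Hölder
  have hHolder := lintegral_exp_le_of_le_add P hsplit hmeasF' hmeasY
  -- Step 3: the first factor is the bounded-class residual at `2β`
  have hA1 : ∫⁻ z, ENNReal.ofReal (Real.exp (2 * (β * ∑ i, w⁻¹ * ∫ r in (0 : ℝ)..w,
      F' (((Φ N).flow r z) i)))) ∂P ≤ ENNReal.ofReal (Real.exp (ε * ((N : ℝ) + 1))) := by
    have h := hN₁ N hNN₁
    refine le_of_eq_of_le (lintegral_congr fun z => ?_) h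
    rw [← mul_assoc]
  -- Step 4: the second factor — Jensen in time, window transfer, fibre moments
  set X : ℝ≥0∞ := ENNReal.ofReal (Real.exp (ε * ((N : ℝ) + 1))) with hXdef
  have hhalf : ENNReal.ofReal (Real.exp (ε / 2 * ((N : ℝ) + 1))) *
      ENNReal.ofReal (Real.exp (ε / 2 * ((N : ℝ) + 1))) = X := by
    rw [hXdef, ← ENNReal.ofReal_mul (Real.exp_pos _).le, ← Real.exp_add]
    congr 2; ring
  have hA2 : ∫⁻ z, ENNReal.ofReal (Real.exp (2 * (|β| * ∑ i, w⁻¹ * ∫ r in (0 : ℝ)..w,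
      Y (((Φ N).flow r z) i)))) ∂P ≤ X := by
    -- rewrite the exponent as a window sum of the non-negative `2|β| Y`
    have hrw : ∀ z, 2 * (|β| * ∑ i, w⁻¹ * ∫ r in (0 : ℝ)..w, Y (((Φ N).flow r z) i)) =
        ∑ i, w⁻¹ * ∫ r in (0 : ℝ)..w, 2 * |β| * Y (((Φ N).flow r z) i) := by
      intro z
      rw [← mul_assoc, Finset.mul_sum]
      refine Finset.sum_congr rfl fun i _ => ?_
      rw [intervalIntegral.integral_const_mul]
      ring
    simp_rw [hrw]
    -- Jensen in time (S1)
    have hJ' := hJ (Config (N + 1) (Fin 3) T3) P (Φ N).good (Φ N).measurableSet_good hPgood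
      (Φ N).flow (Φ N).measurable_flow_prod_torus (N + 1) (fun i z => 2 * |β| * Y (z i))
      (fun i => (hYc.measurable.comp (measurable_pi_apply i)).const_mul _)
      (fun i z => mul_nonneg (mul_nonneg zero_le_two (abs_nonneg β)) (hY0 _)) w hw
    refine hJ'.trans (iSup₂_le fun r hr => ?_)
    -- window transfer (S5) at time `r`
    set Gf : Config (N + 1) (Fin 3) T3 → ℝ≥0∞ :=
      fun z => ENNReal.ofReal (Real.exp (∑ i, 2 * |β| * Y (z i))) with hGfdef
    have hGm : Measurable Gf := by
      refine (Real.measurable_exp.comp (Finset.measurable_sum _ fun i _ => ?_)).ennreal_ofReal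
      exact (hYc.measurable.comp (measurable_pi_apply i)).const_mul _
    have hT := hN₂ N hNN₂ r hr Gf hGm
    refine hT.trans ?_
    -- the `q`-th power is a product of one-body factors
    set g : T3 × V3 → ℝ≥0∞ := fun y => ENNReal.ofReal (Real.exp (q * (2 * |β| * Y y))) with hgdef
    have hgm : Measurable g :=
      (Real.measurable_exp.comp ((hYc.measurable.const_mul _).const_mul _)).ennreal_ofReal
    have hGq : ∀ z, Gf z ^ q = ∏ i, g (z i) := by
      intro z
      rw [hGfdef]
      simp only []
      rw [ENNReal.ofReal_rpow_of_nonneg (Real.exp_pos _).le hq0.le, ← Real.exp_mul, Finset.sum_mul,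
        Real.exp_sum, ENNReal.ofReal_prod_of_nonneg fun i _ => (Real.exp_pos _).le]
      refine Finset.prod_congr rfl fun i _ => ?_
      rw [hgdef]
      simp only []
      congr 2; ring
    simp_rw [hGq]
    -- fibre exponential moments (S2) fed by the truncation's tail clause
    set K : ℝ≥0∞ := ENNReal.ofReal (Real.exp (ε / 2)) with hKdef
    have hK1 : 1 ≤ K := by
      rw [hKdef, ← ENNReal.ofReal_one]
      exact ENNReal.ofReal_le_ofReal (Real.one_le_exp (by positivity))
    have hfib : ∫⁻ z, ∏ i, g (z i) ∂P ≤ K ^ (N + 1) := by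
      rw [hPdef, Literature.MathematicalPhysics.KineticTheory.localGibbsLaw_eq]
      refine hFib a θ₀ u₀ ha hθ hu ha0 hθ0 σ hσ hσ2 N g hgm K fun x => ?_
      refine le_trans (lintegral_mono fun v => ?_) (hYexp x)
      rw [hgdef]
      simp only []
      rw [← ENNReal.ofReal_mul (Real.exp_pos _).le]
      refine ENNReal.ofReal_le_ofReal (mul_le_mul_of_nonneg_right (Real.exp_le_exp.2 ?_)
        (Literature.MathematicalPhysics.KineticTheory.localMaxwellian_nonneg zero_le_one (hθ0 x).le _ _))
      rw [← mul_assoc]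
      exact mul_le_mul_of_nonneg_right hqβ (hY0 _)
    have hKpow : K ^ (N + 1) = ENNReal.ofReal (Real.exp (ε / 2 * ((N : ℝ) + 1))) := by
      rw [hKdef, ← ENNReal.ofReal_pow (Real.exp_pos _).le, ← Real.exp_nat_mul]
      congr 2; push_cast; ring
    have hroot : (∫⁻ z, ∏ i, g (z i) ∂P) ^ (1 / q) ≤ ENNReal.ofReal (Real.exp (ε / 2 * ((N : ℝ) + 1))) := by
      refine (ENNReal.rpow_le_rpow hfib (by positivity)).trans ?_
      rw [← hKpow]
      refine ennreal_rpow_le_self_of_one_le (one_le_pow_of_one_le' hK1 _) ?_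
      rw [div_le_one hq0]; exact hq
    rw [← hhalf]
    exact mul_le_mul' le_rfl hroot
  -- Step 5: combine
  calc ∫⁻ z, ENNReal.ofReal (Real.exp (β * ∑ i, w⁻¹ * ∫ r in (0 : ℝ)..w, F (((Φ N).flow r z) i))) ∂P
      ≤ _ := hHolder
    _ ≤ X ^ (1 / 2 : ℝ) * X ^ (1 / 2 : ℝ) :=
        mul_le_mul' (ENNReal.rpow_le_rpow hA1 (by norm_num)) (ENNReal.rpow_le_rpow hA2 (by norm_num))
    _ = X := by
        rw [← ENNReal.rpow_add _ _ (ENNReal.ofReal_pos.2 (Real.exp_pos _)).ne' ENNReal.ofReal_ne_top,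
          show (1 / 2 : ℝ) + 1 / 2 = 1 by norm_num, ENNReal.rpow_one]

end Summit.AtomisticToContinuum.HydrodynamicLimit.Theorems.KineticCurrentsWindowLDUniformSketch
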